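import Literature.Analysis.FluidPDE.PassiveVectorTestForms
import Literature.Analysis.FunctionSpaces.TorusFluidGlueProofs
import HarnessLib

/-!
# The damped passive-vector operator on space–time tests as an element of `L²((0,T) × T^d)`

Analysis/FluidPDE proof-support file (everything proved; no definitions). Plumbing for J.-L. Lions'
existence theorem (`OperatorTheory.LionsProjection.exists_eq_of_coercive`) applied to the passive
solenoidal vector equation (`Torus.IsWeakPassiveVectorOn 0`, Yoshida–Kaneda 2000 (4)–(5)) in the Hilbert space
`L²(μ_T)`, `μ_T = (vol|(0,T)) ⊗ vol_{T^d}` (Lions–Magenes 1972, Chap. 3, §4.3: `F = L²(0,T;H)`-type space,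
`Φ` = smooth tests vanishing at `t = T`):

* space–time test fields and the image `∂ₜψ - ψ + (b·∇)ψ + νΔψ` of a test field under the damped
  operator (carrier `b` bounded a.e. and jointly measurable) are in `L²(μ_T)` (indeed bounded);
* **undamping**: if `v` satisfies the damped weak identity
  `-∫_{μ_T}⟪v, ∂ₜψ - ψ + (b·∇)ψ + νΔψ⟫ = ∫⟪w₀, ψ(0)⟫` for all divergence-free space–time tests `ψ`, then
  `u(t) = e^{t} v(t)` satisfies the undamped one `∫_{μ_T}⟪u, ∂ₜψ + (b·∇)ψ + νΔψ⟫ + ∫⟪w₀, ψ(0)⟫ = 0`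
  (test with `e^{t}ψ`).

## Mathlib / tree search

Tree: `PassiveVectorTestForms`, `TorusWeakFormBookkeeping` (`IsSpaceTimeTest.exists_bound*`,
`continuous_uncurry*`), `TorusTestFunction` (`IsSpaceTimeTest.smul/add/timeDeriv`). Mathlib: `memLp_top_of_bound`,
`MemLp.mono_exponent`.

## References

* J.-L. Lions, E. Magenes, *Non-homogeneous boundary value problems and applications* I (1972), Chap. 3, §4.3.
  [`LionsMagenes1972`]
* K. Yoshida, Y. Kaneda, Phys. Rev. E 63 (2000) 016308, §II eq. (4)–(5). [`YoshidaKaneda2000`]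
-/

noncomputable section

open MeasureTheory Set Filter Function TopologicalSpace
open scoped ENNReal NNReal InnerProductSpace Topology

namespace Literature.Analysis.FluidPDE

namespace Torus

variable {d : Type*} [Fintype d] [DecidableEq d]

/-! ## Test fields and their images under the damped operator are in `L²(μ_T)` -/

omit [DecidableEq d] in
/-- Points of `(0,T) × T^d` have their time coordinate in `(0,T)`, a.e. [folklore] -/
private theorem ae_fst_mem_Ioo_prod' (T : ℝ) :
    ∀ᵐ p : ℝ × UnitAddTorus d ∂(((volume : Measure ℝ).restrict (Ioo 0 T)).prod volume), p.1 ∈ Ioo 0 T :=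
  (Measure.quasiMeasurePreserving_fst (μ := (volume : Measure ℝ).restrict (Ioo 0 T))
    (ν := (volume : Measure (UnitAddTorus d)))).ae (ae_restrict_mem measurableSet_Ioo)

omit [DecidableEq d] in
/-- A space–time test field is in `L²((0,T) × T^d)` (bounded and continuous on `[0,T] × T^d`).
[cite: LionsMagenes1972, Chap. 3 §4.3] -/
theorem _root_.Literature.Analysis.FunctionSpaces.Torus.IsSpaceTimeTest.memLp_two_uncurry {T : ℝ} {ψ : ℝ → UnitAddTorus d → EuclideanSpace ℝ d}
    (hψ : FunctionSpaces.Torus.IsSpaceTimeTest T ψ) :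
    MemLp (uncurry ψ) 2 (((volume : Measure ℝ).restrict (Ioo 0 T)).prod volume) := by
  obtain ⟨C, hC⟩ := hψ.exists_bound (isCompact_Icc (a := (0:ℝ)) (b := T))
  have htop : MemLp (uncurry ψ) ∞ (((volume : Measure ℝ).restrict (Ioo 0 T)).prod volume) := by
    refine memLp_top_of_bound hψ.continuous_uncurry.aestronglyMeasurable C ?_
    filter_upwards [ae_fst_mem_Ioo_prod' (d := d) T] with p hp
    exact hC p.1 (Ioo_subset_Icc_self hp) p.2
  exact htop.mono_exponent le_top

/-- The transport term `(b·∇)ψ` of a space–time test field is bounded a.e. and jointly measurable on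
`(0,T) × T^d` when `‖b‖ ≤ M` a.e. there, hence in `L²(μ_T)`. [cite: LionsMagenes1972, Chap. 3 §4.3] -/
theorem memLp_two_convect_test {T : ℝ} {b ψ : ℝ → UnitAddTorus d → EuclideanSpace ℝ d}
    (hψ : FunctionSpaces.Torus.IsSpaceTimeTest T ψ)
    (hbm : AEStronglyMeasurable (uncurry b) (((volume : Measure ℝ).restrict (Ioo 0 T)).prod volume)) {M : ℝ}
    (hbM : ∀ᵐ p ∂(((volume : Measure ℝ).restrict (Ioo 0 T)).prod (volume : Measure (UnitAddTorus d))),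
      ‖uncurry b p‖ ≤ M) :
    MemLp (fun p : ℝ × UnitAddTorus d => FunctionSpaces.Torus.convect (b p.1) (ψ p.1) p.2) 2
      (((volume : Measure ℝ).restrict (Ioo 0 T)).prod volume) := by
  obtain ⟨C₂, -, hC₂⟩ := hψ.exists_bound_sum_partialDeriv (isCompact_Icc (a := (0:ℝ)) (b := T))
  have hψ1 : ∀ t, FunctionSpaces.Torus.IsContDiff 1 (ψ t) := fun t => (hψ.isSmooth_slice t).isContDiff (by simp)
  have hm : AEStronglyMeasurable (fun p : ℝ × UnitAddTorus d => FunctionSpaces.Torus.convect (b p.1) (ψ p.1) p.2)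
      (((volume : Measure ℝ).restrict (Ioo 0 T)).prod volume) := by
    have e : (fun p : ℝ × UnitAddTorus d => FunctionSpaces.Torus.convect (b p.1) (ψ p.1) p.2) =
        fun p => ∑ j, b p.1 p.2 j • FunctionSpaces.Torus.partialDeriv j (ψ p.1) p.2 := by
      funext p
      exact FunctionSpaces.Torus.convect_eq_sum_smul_partialDeriv (hψ1 p.1) _
    rw [e]
    refine Finset.aestronglyMeasurable_fun_sum _ fun j _ => ?_
    exact ((EuclideanSpace.proj j).continuous.comp_aestronglyMeasurable hbm).smul
      (hψ.continuous_uncurry_lineDeriv (EuclideanSpace.single j 1)).aestronglyMeasurable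
  have htop : MemLp (fun p : ℝ × UnitAddTorus d => FunctionSpaces.Torus.convect (b p.1) (ψ p.1) p.2) ∞
      (((volume : Measure ℝ).restrict (Ioo 0 T)).prod volume) := by
    refine memLp_top_of_bound hm (M * C₂) ?_
    filter_upwards [hbM, ae_fst_mem_Ioo_prod' (d := d) T] with p hp hpI
    calc ‖FunctionSpaces.Torus.convect (b p.1) (ψ p.1) p.2‖
        ≤ ‖b p.1 p.2‖ * ∑ j, ‖FunctionSpaces.Torus.partialDeriv j (ψ p.1) p.2‖ :=
          FunctionSpaces.Torus.norm_convect_le _ (hψ1 p.1) p.2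
      _ ≤ M * C₂ := mul_le_mul hp (hC₂ p.1 (Ioo_subset_Icc_self hpI) p.2)
          (Finset.sum_nonneg fun j _ => norm_nonneg _) ((norm_nonneg _).trans hp)
  exact htop.mono_exponent le_top

/-- **The image of a test field under the damped operator is in `L²(μ_T)`**:
`(t,x) ↦ ∂ₜψ - ψ + (b·∇)ψ + νΔψ` for a space–time test `ψ` and a carrier bounded a.e. on `(0,T) × T^d`.
[cite: LionsMagenes1972, Chap. 3 §4.3] -/
theorem memLp_two_dampedOp {T ν : ℝ} {b ψ : ℝ → UnitAddTorus d → EuclideanSpace ℝ d}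
    (hψ : FunctionSpaces.Torus.IsSpaceTimeTest T ψ)
    (hbm : AEStronglyMeasurable (uncurry b) (((volume : Measure ℝ).restrict (Ioo 0 T)).prod volume)) {M : ℝ}
    (hbM : ∀ᵐ p ∂(((volume : Measure ℝ).restrict (Ioo 0 T)).prod (volume : Measure (UnitAddTorus d))),
      ‖uncurry b p‖ ≤ M) :
    MemLp (fun p : ℝ × UnitAddTorus d => FunctionSpaces.Torus.timeDeriv ψ p.1 p.2 - ψ p.1 p.2 +
        FunctionSpaces.Torus.convect (b p.1) (ψ p.1) p.2 + ν • FunctionSpaces.Torus.laplacian (ψ p.1) p.2) 2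
      (((volume : Measure ℝ).restrict (Ioo 0 T)).prod volume) := by
  have h1 : MemLp (uncurry (FunctionSpaces.Torus.timeDeriv ψ)) 2 (((volume : Measure ℝ).restrict (Ioo 0 T)).prod volume) :=
    hψ.timeDeriv.memLp_two_uncurry
  have h2 := hψ.memLp_two_uncurry
  have h3 := memLp_two_convect_test hψ hbm hbM
  have h4 : MemLp (uncurry fun t x => FunctionSpaces.Torus.laplacian (ψ t) x) 2
      (((volume : Measure ℝ).restrict (Ioo 0 T)).prod volume) := by
    obtain ⟨C, hC⟩ := exists_bound_of_continuous_uncurry hψ.continuous_uncurry_laplacian 0 T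
    have htop : MemLp (uncurry fun t x => FunctionSpaces.Torus.laplacian (ψ t) x) ∞
        (((volume : Measure ℝ).restrict (Ioo 0 T)).prod volume) := by
      refine memLp_top_of_bound hψ.continuous_uncurry_laplacian.aestronglyMeasurable C ?_
      filter_upwards [ae_fst_mem_Ioo_prod' (d := d) T] with p hp
      exact hC p.1 (Ioo_subset_Icc_self hp) p.2
    exact htop.mono_exponent le_top
  exact ((h1.sub h2).add h3).add (h4.const_smul ν)

/-! ## Undamping -/

omit [DecidableEq d] in
/-- `e^{t} • ψ` is a space–time test field when `ψ` is (smooth time weight). [cite: LionsMagenes1972, Chap. 3 §4.3] -/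
theorem _root_.Literature.Analysis.FunctionSpaces.Torus.IsSpaceTimeTest.exp_smul {T : ℝ} {ψ : ℝ → UnitAddTorus d → EuclideanSpace ℝ d}
    (hψ : FunctionSpaces.Torus.IsSpaceTimeTest T ψ) :
    FunctionSpaces.Torus.IsSpaceTimeTest T (fun t x => Real.exp t • ψ t x) := by
  obtain ⟨hs, T', hT', h0⟩ := hψ
  refine ⟨?_, T', hT', fun t ht => ?_⟩
  · have e : FunctionSpaces.Torus.stLift (fun t x => Real.exp t • ψ t x) =
        fun p : ℝ × EuclideanSpace ℝ d => Real.exp p.1 • FunctionSpaces.Torus.stLift ψ p := by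
      funext p; rfl
    rw [e]
    exact (Real.contDiff_exp.comp contDiff_fst).smul hs
  · funext x
    simp [h0 t ht]

omit [DecidableEq d] in
/-- Time derivative of `e^{t} • ψ`: `∂ₜ(e^{t}ψ) = e^{t}ψ + e^{t}∂ₜψ`. [folklore] -/
private theorem timeDeriv_exp_smul {T : ℝ} {ψ : ℝ → UnitAddTorus d → EuclideanSpace ℝ d}
    (hψ : FunctionSpaces.Torus.IsSpaceTimeTest T ψ) (t : ℝ) (x : UnitAddTorus d) :
    FunctionSpaces.Torus.timeDeriv (fun t x => Real.exp t • ψ t x) t x =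
      Real.exp t • ψ t x + Real.exp t • FunctionSpaces.Torus.timeDeriv ψ t x := by
  have hd : HasDerivAt (fun τ => ψ τ x) (FunctionSpaces.Torus.timeDeriv ψ t x) t := by
    have hdiff : DifferentiableAt ℝ (fun τ => ψ τ x) t := by
      obtain ⟨y, rfl⟩ := FunctionSpaces.Torus.proj_surjective x
      have h : (fun τ : ℝ => ψ τ (FunctionSpaces.Torus.proj y)) = FunctionSpaces.Torus.stLift ψ ∘ fun τ : ℝ => (τ, y) := by
        funext τ; rfl
      rw [h]
      exact ((hψ.1.differentiable (by simp)).differentiableAt).comp t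
        (differentiableAt_id.prodMk (differentiableAt_const _))
    exact hdiff.hasDerivAt
  have h := (Real.hasDerivAt_exp t).smul hd
  simp only [FunctionSpaces.Torus.timeDeriv] at h ⊢
  rw [show (fun τ => Real.exp τ • ψ τ x) = (Real.exp • fun τ => ψ τ x) from rfl, h.deriv, add_comm]

omit [Fintype d] in
/-- `∂ᵢ (c f) = c ∂ᵢ f` for real functions on `T^d`. [folklore] -/
private theorem partialDeriv_const_mul₀ (c : ℝ) (f : UnitAddTorus d → ℝ) (i : d) (x : UnitAddTorus d) :
    FunctionSpaces.Torus.partialDeriv i (fun y => c * f y) x = c * FunctionSpaces.Torus.partialDeriv i f x := by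
  simp only [FunctionSpaces.Torus.partialDeriv, FunctionSpaces.Torus.lineDeriv, deriv_const_mul_field']

/-- A constant multiple of a divergence-free field is divergence free. [folklore] -/
private theorem isDivFree_const_smul₀ {G : UnitAddTorus d → EuclideanSpace ℝ d}
    (hG : FunctionSpaces.Torus.IsDivFree G) (c : ℝ) : FunctionSpaces.Torus.IsDivFree (c • G) := by
  intro x
  have h : ∀ i : d, FunctionSpaces.Torus.partialDeriv i (fun y => (c • G) y i) x =
      c * FunctionSpaces.Torus.partialDeriv i (fun y => G y i) x := by
    intro i
    have e : (fun y => (c • G) y i) = fun y => c * G y i := by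
      funext y; simp [Pi.smul_apply, smul_eq_mul]
    rw [e, partialDeriv_const_mul₀]
  unfold FunctionSpaces.Torus.divergence
  simp_rw [h]
  rw [← Finset.mul_sum]
  have h0 := hG x
  unfold FunctionSpaces.Torus.divergence at h0
  rw [h0, mul_zero]

omit [DecidableEq d] in
/-- `(u·∇)(c • G) = c • (u·∇)G` for a `C¹` field. [folklore] -/
private theorem convect_const_smul₀ {G : UnitAddTorus d → EuclideanSpace ℝ d} (hG : FunctionSpaces.Torus.IsContDiff 1 G)
    (c : ℝ) (u : UnitAddTorus d → EuclideanSpace ℝ d) (x : UnitAddTorus d) :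
    FunctionSpaces.Torus.convect u (c • G) x = c • FunctionSpaces.Torus.convect u G x := by
  simp only [FunctionSpaces.Torus.convect]
  rw [FunctionSpaces.Torus.fderiv_const_smul hG]
  rfl

/-- **Undamping.** If `v` satisfies the damped weak identity
`∫_{μ_T}⟪v, ∂ₜψ - ψ + (b·∇)ψ + νΔψ⟫ + ∫⟪w₀, ψ(0)⟫ = 0` for all divergence-free space–time tests `ψ`, then
`u = e^{t} v` satisfies the undamped one, `∫_{μ_T}⟪e^{t}v, ∂ₜψ + (b·∇)ψ + νΔψ⟫ + ∫⟪w₀, ψ(0)⟫ = 0` (test the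
damped identity with `e^{t}ψ`: `∂ₜ(e^{t}ψ) - e^{t}ψ = e^{t}∂ₜψ`). [cite: LionsMagenes1972, Chap. 3 §4.3] -/
theorem undamped_weak_of_damped {T ν : ℝ} {b : ℝ → UnitAddTorus d → EuclideanSpace ℝ d}
    {v : ℝ × UnitAddTorus d → EuclideanSpace ℝ d} {w₀ : UnitAddTorus d → EuclideanSpace ℝ d}
    (hdamped : ∀ ψ : ℝ → UnitAddTorus d → EuclideanSpace ℝ d, FunctionSpaces.Torus.IsSpaceTimeTest T ψ →
      FunctionSpaces.Torus.IsDivFreeTest ψ →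
      (∫ p, ⟪v p, FunctionSpaces.Torus.timeDeriv ψ p.1 p.2 - ψ p.1 p.2 +
          FunctionSpaces.Torus.convect (b p.1) (ψ p.1) p.2 + ν • FunctionSpaces.Torus.laplacian (ψ p.1) p.2⟫_ℝ
          ∂(((volume : Measure ℝ).restrict (Ioo 0 T)).prod volume)) + ∫ x, ⟪w₀ x, ψ 0 x⟫_ℝ = 0)
    {ψ : ℝ → UnitAddTorus d → EuclideanSpace ℝ d} (hψ : FunctionSpaces.Torus.IsSpaceTimeTest T ψ)
    (hdiv : FunctionSpaces.Torus.IsDivFreeTest ψ) :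
    (∫ p, ⟪Real.exp p.1 • v p, FunctionSpaces.Torus.timeDeriv ψ p.1 p.2 +
        FunctionSpaces.Torus.convect (b p.1) (ψ p.1) p.2 + ν • FunctionSpaces.Torus.laplacian (ψ p.1) p.2⟫_ℝ
        ∂(((volume : Measure ℝ).restrict (Ioo 0 T)).prod volume)) + ∫ x, ⟪w₀ x, ψ 0 x⟫_ℝ = 0 := by
  have hΨ := hψ.exp_smul
  have hΨdiv : FunctionSpaces.Torus.IsDivFreeTest (fun t x => Real.exp t • ψ t x) := fun t => by
    show FunctionSpaces.Torus.IsDivFree (Real.exp t • ψ t)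
    exact isDivFree_const_smul₀ (hdiv t) _
  have key := hdamped _ hΨ hΨdiv
  have hψ1 : ∀ t, FunctionSpaces.Torus.IsContDiff 1 (ψ t) := fun t => (hψ.isSmooth_slice t).isContDiff (by simp)
  have hpt : ∀ p : ℝ × UnitAddTorus d,
      ⟪v p, FunctionSpaces.Torus.timeDeriv (fun t x => Real.exp t • ψ t x) p.1 p.2 - Real.exp p.1 • ψ p.1 p.2 +
          FunctionSpaces.Torus.convect (b p.1) ((fun t x => Real.exp t • ψ t x) p.1) p.2 +
          ν • FunctionSpaces.Torus.laplacian ((fun t x => Real.exp t • ψ t x) p.1) p.2⟫_ℝ =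
        ⟪Real.exp p.1 • v p, FunctionSpaces.Torus.timeDeriv ψ p.1 p.2 +
          FunctionSpaces.Torus.convect (b p.1) (ψ p.1) p.2 + ν • FunctionSpaces.Torus.laplacian (ψ p.1) p.2⟫_ℝ := by
    intro p
    rw [timeDeriv_exp_smul hψ, show ((fun t x => Real.exp t • ψ t x) p.1) = Real.exp p.1 • ψ p.1 from rfl,
      convect_const_smul₀ (hψ1 p.1), FunctionSpaces.Torus.laplacian_const_smul_apply (hψ.isSmooth_slice p.1)]
    rw [real_inner_smul_left, ← real_inner_smul_right]
    congr 1
    rw [smul_add, smul_add, smul_comm ν (Real.exp p.1)]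
    abel
  have e0 : (fun x => ⟪w₀ x, (fun t x => Real.exp t • ψ t x) 0 x⟫_ℝ) = fun x => ⟪w₀ x, ψ 0 x⟫_ℝ := by
    funext x
    simp
  rw [integral_congr_ae (ae_of_all _ hpt), e0] at key
  exact key

/-! ## Linearity of the damped operator in the test field -/

omit [DecidableEq d] in
/-- A space–time test field is differentiable in time at every point (slice of the smooth lift). [folklore] -/
private theorem hasDerivAt_slice_test {T : ℝ} {ψ : ℝ → UnitAddTorus d → EuclideanSpace ℝ d}
    (hψ : FunctionSpaces.Torus.IsSpaceTimeTest T ψ) (t : ℝ) (x : UnitAddTorus d) :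
    HasDerivAt (fun τ => ψ τ x) (FunctionSpaces.Torus.timeDeriv ψ t x) t := by
  have hdiff : DifferentiableAt ℝ (fun τ => ψ τ x) t := by
    obtain ⟨y, rfl⟩ := FunctionSpaces.Torus.proj_surjective x
    have h : (fun τ : ℝ => ψ τ (FunctionSpaces.Torus.proj y)) = FunctionSpaces.Torus.stLift ψ ∘ fun τ : ℝ => (τ, y) := by
      funext τ; rfl
    rw [h]
    exact ((hψ.1.differentiable (by simp)).differentiableAt).comp t
      (differentiableAt_id.prodMk (differentiableAt_const _))
  exact hdiff.hasDerivAt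

omit [DecidableEq d] in
/-- `∂ₜ(ψ + χ) = ∂ₜψ + ∂ₜχ` for space–time test fields. [folklore] -/
private theorem timeDeriv_add_test {T : ℝ} {ψ χ : ℝ → UnitAddTorus d → EuclideanSpace ℝ d}
    (hψ : FunctionSpaces.Torus.IsSpaceTimeTest T ψ) (hχ : FunctionSpaces.Torus.IsSpaceTimeTest T χ)
    (t : ℝ) (x : UnitAddTorus d) :
    FunctionSpaces.Torus.timeDeriv (ψ + χ) t x = FunctionSpaces.Torus.timeDeriv ψ t x + FunctionSpaces.Torus.timeDeriv χ t x := by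
  have h := (hasDerivAt_slice_test hψ t x).add (hasDerivAt_slice_test hχ t x)
  simp only [FunctionSpaces.Torus.timeDeriv] at h ⊢
  exact h.deriv

omit [DecidableEq d] in
/-- `∂ₜ(c • ψ) = c • ∂ₜψ` for a space–time test field. [folklore] -/
private theorem timeDeriv_const_smul_test {T : ℝ} {ψ : ℝ → UnitAddTorus d → EuclideanSpace ℝ d}
    (hψ : FunctionSpaces.Torus.IsSpaceTimeTest T ψ) (c : ℝ) (t : ℝ) (x : UnitAddTorus d) :
    FunctionSpaces.Torus.timeDeriv (c • ψ) t x = c • FunctionSpaces.Torus.timeDeriv ψ t x := by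
  have h := (hasDerivAt_slice_test hψ t x).const_smul c
  simp only [FunctionSpaces.Torus.timeDeriv] at h ⊢
  exact h.deriv

omit [DecidableEq d] in
/-- `Δ(f + g) = Δf + Δg` for smooth fields on the torus. [folklore] -/
private theorem laplacian_add_apply₀ {f g : UnitAddTorus d → EuclideanSpace ℝ d}
    (hf : FunctionSpaces.Torus.IsSmooth f) (hg : FunctionSpaces.Torus.IsSmooth g) (x : UnitAddTorus d) :
    FunctionSpaces.Torus.laplacian (f + g) x = FunctionSpaces.Torus.laplacian f x + FunctionSpaces.Torus.laplacian g x := by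
  rw [FunctionSpaces.Torus.laplacian, FunctionSpaces.Torus.laplacian, FunctionSpaces.Torus.laplacian,
    show FunctionSpaces.Torus.liftAt (f + g) x = FunctionSpaces.Torus.liftAt f x + FunctionSpaces.Torus.liftAt g x from rfl]
  rw [((hf.isContDiff (n := 2) (WithTop.coe_le_coe.mpr le_top)).liftAt x).contDiffAt.laplacian_add
    ((hg.isContDiff (n := 2) (WithTop.coe_le_coe.mpr le_top)).liftAt x).contDiffAt]

omit [DecidableEq d] in
/-- **The damped operator is additive in the test field**:
`L(ψ + χ) = Lψ + Lχ` pointwise, `Lψ = ∂ₜψ - ψ + (b·∇)ψ + νΔψ`. [cite: LionsMagenes1972, Chap. 3 §4.3] -/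
theorem dampedOp_add {T ν : ℝ} {b ψ χ : ℝ → UnitAddTorus d → EuclideanSpace ℝ d}
    (hψ : FunctionSpaces.Torus.IsSpaceTimeTest T ψ) (hχ : FunctionSpaces.Torus.IsSpaceTimeTest T χ)
    (p : ℝ × UnitAddTorus d) :
    FunctionSpaces.Torus.timeDeriv (ψ + χ) p.1 p.2 - (ψ + χ) p.1 p.2 +
        FunctionSpaces.Torus.convect (b p.1) ((ψ + χ) p.1) p.2 + ν • FunctionSpaces.Torus.laplacian ((ψ + χ) p.1) p.2 =
      (FunctionSpaces.Torus.timeDeriv ψ p.1 p.2 - ψ p.1 p.2 +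
          FunctionSpaces.Torus.convect (b p.1) (ψ p.1) p.2 + ν • FunctionSpaces.Torus.laplacian (ψ p.1) p.2) +
        (FunctionSpaces.Torus.timeDeriv χ p.1 p.2 - χ p.1 p.2 +
          FunctionSpaces.Torus.convect (b p.1) (χ p.1) p.2 + ν • FunctionSpaces.Torus.laplacian (χ p.1) p.2) := by
  have hψ1 : FunctionSpaces.Torus.IsContDiff 1 (ψ p.1) := (hψ.isSmooth_slice p.1).isContDiff (by simp)
  have hχ1 : FunctionSpaces.Torus.IsContDiff 1 (χ p.1) := (hχ.isSmooth_slice p.1).isContDiff (by simp)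
  rw [timeDeriv_add_test hψ hχ, show (ψ + χ) p.1 = ψ p.1 + χ p.1 from rfl,
    laplacian_add_apply₀ (hψ.isSmooth_slice p.1) (hχ.isSmooth_slice p.1)]
  simp only [FunctionSpaces.Torus.convect, Pi.add_apply]
  rw [FunctionSpaces.Torus.fderiv_add hψ1 hχ1]
  simp only [FunLike.coe_add, Pi.add_apply, smul_add]
  abel

omit [DecidableEq d] in
/-- **The damped operator is homogeneous in the test field**: `L(c • ψ) = c • Lψ` pointwise.
[cite: LionsMagenes1972, Chap. 3 §4.3] -/
theorem dampedOp_const_smul {T ν : ℝ} {b ψ : ℝ → UnitAddTorus d → EuclideanSpace ℝ d}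
    (hψ : FunctionSpaces.Torus.IsSpaceTimeTest T ψ) (c : ℝ) (p : ℝ × UnitAddTorus d) :
    FunctionSpaces.Torus.timeDeriv (c • ψ) p.1 p.2 - (c • ψ) p.1 p.2 +
        FunctionSpaces.Torus.convect (b p.1) ((c • ψ) p.1) p.2 + ν • FunctionSpaces.Torus.laplacian ((c • ψ) p.1) p.2 =
      c • (FunctionSpaces.Torus.timeDeriv ψ p.1 p.2 - ψ p.1 p.2 +
        FunctionSpaces.Torus.convect (b p.1) (ψ p.1) p.2 + ν • FunctionSpaces.Torus.laplacian (ψ p.1) p.2) := by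
  have hψ1 : FunctionSpaces.Torus.IsContDiff 1 (ψ p.1) := (hψ.isSmooth_slice p.1).isContDiff (by simp)
  rw [timeDeriv_const_smul_test hψ, show (c • ψ) p.1 = c • ψ p.1 from rfl, convect_const_smul₀ hψ1,
    FunctionSpaces.Torus.laplacian_const_smul_apply (hψ.isSmooth_slice p.1)]
  simp only [Pi.smul_apply, smul_add, smul_sub, smul_comm ν c]

end Torus

end Literature.Analysis.FluidPDE

end
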